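import Summits.CriticalPhenomena.PercolationContinuityZ3.Theorems.PercNearOneGluingNoHeavyLowerTailFaceCertKernel
import HarnessLib

/-!
# `NoHeavyLowerTail` (stmt-CriticalPhenomena-4575) — kernel certificate engine, N-variable version (up to 256 cells)

Support file (prover prim-cert-2 gen 11; `--supports stmt-CriticalPhenomena-4575`).  No named facts, no sorries.

`…FaceCertKernel` (p203180) replays exact Positivstellensatz-type certificates `M·T = Σ_r m_r·g_r + C` in the FIFTEEN
cells of a four-point law.  The law-level certificates now requested on FIVE terminals (the atomwise exchange lemmas
`Φ(0)`, `Ψ(0)` of the `2+k` gluing kernel, LEAD-GEN11 §3h / ttrl `lead-gen11-face-lemmas-PHI-PSI-cert`; the `X′(5)` cell-cone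
certificate) live on the `52` cells of the partition law `Π₅`, joint laws beyond.  This is the same engine with the number
of variables freed: the kernel-side structures and operations are REUSED from `FaceCertKernel` (`PPoly`, `MTree`, `smulP`,
`mergeP`, `mulPP`, `constP`, `powPP`, `applyT`, `subCheckP`, `coeffsP`, `coeffsT` act on Gödel codes only); the Gödel base
is the table of the first `256` primes (`ptabN`, `toPPN`, `wfN`, `rhoPN`); the semantics takes a plain valuation
`v : ℕ → R` (`monoN`, `evalP`, `evalT`, and `evalE` = value of a reflected `Lean.Grind.CommRing.Expr`, numerals as casts);
soundness `evalP_toPPN`, `evalP_eq_of_subCheckP`, `evalP_applyT`, `evalP_rhoPN`, `evalP_nonneg_of_coeffsP`,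
`evalT_nonneg_of_coeffsT`; and THE SCHEMA `cert_mul_nonneg` / `cert_nonneg`: a kernel-checked
`subCheckP (M·T) (certRHS m₀ rows)` with nonnegative multipliers and rows gives `0 ≤ M·T` (resp. `0 ≤ T` for `M > 0`) at
every valuation nonnegative on `0..255` — a certificate file supplies the data, three `decide +kernel` checks and the
row dictionary `evalE v gᵣ = (named theorem instance)` (`simp [evalE]`).
-/

open Lean.Grind.CommRing (Expr)

namespace Summit.CriticalPhenomena.PercolationContinuityZ3.Theorems

namespace FaceCertKernelN

open FaceCertKernel

/-! ### Gödel base and kernel-side operations -/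

/-- The first `256` primes. [folklore] -/
def ptabList : List Nat :=
  [ 2, 3, 5, 7, 11, 13, 17, 19, 23, 29, 31, 37, 41, 43, 47, 53,
    59, 61, 67, 71, 73, 79, 83, 89, 97, 101, 103, 107, 109, 113, 127, 131,
    137, 139, 149, 151, 157, 163, 167, 173, 179, 181, 191, 193, 197, 199, 211, 223,
    227, 229, 233, 239, 241, 251, 257, 263, 269, 271, 277, 281, 283, 293, 307, 311,
    313, 317, 331, 337, 347, 349, 353, 359, 367, 373, 379, 383, 389, 397, 401, 409,
    419, 421, 431, 433, 439, 443, 449, 457, 461, 463, 467, 479, 487, 491, 499, 503,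
    509, 521, 523, 541, 547, 557, 563, 569, 571, 577, 587, 593, 599, 601, 607, 613,
    617, 619, 631, 641, 643, 647, 653, 659, 661, 673, 677, 683, 691, 701, 709, 719,
    727, 733, 739, 743, 751, 757, 761, 769, 773, 787, 797, 809, 811, 821, 823, 827,
    829, 839, 853, 857, 859, 863, 877, 881, 883, 887, 907, 911, 919, 929, 937, 941,
    947, 953, 967, 971, 977, 983, 991, 997, 1009, 1013, 1019, 1021, 1031, 1033, 1039, 1049,
    1051, 1061, 1063, 1069, 1087, 1091, 1093, 1097, 1103, 1109, 1117, 1123, 1129, 1151, 1153, 1163,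
    1171, 1181, 1187, 1193, 1201, 1213, 1217, 1223, 1229, 1231, 1237, 1249, 1259, 1277, 1279, 1283,
    1289, 1291, 1297, 1301, 1303, 1307, 1319, 1321, 1327, 1361, 1367, 1373, 1381, 1399, 1409, 1423,
    1427, 1429, 1433, 1439, 1447, 1451, 1453, 1459, 1471, 1481, 1483, 1487, 1489, 1493, 1499, 1511,
    1523, 1531, 1543, 1549, 1553, 1559, 1567, 1571, 1579, 1583, 1597, 1601, 1607, 1609, 1613, 1619 ]

/-- Gödel base of variable `i`: the `(i+1)`-st prime for `i < 256`, and `1` beyond. [folklore] -/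
def ptabN (i : Nat) : Nat := ptabList.getD i 1

/-- Evaluation of a reflected ring expression (core `grind` syntax, variables `0..255`) into a `PPoly`. [folklore] -/
noncomputable def toPPN (e : Expr) : PPoly :=
  Expr.rec (motive := fun _ => PPoly)
    (fun k => constP k) (fun n => constP n) (fun k => constP k) (fun i => .cons (ptabN i) 1 .nil)
    (fun _ ih => smulP (-1) 1 ih) (fun _ _ ih₁ ih₂ => mergeP ih₁ ih₂) (fun _ _ ih₁ ih₂ => mergeP ih₁ (smulP (-1) 1 ih₂))
    (fun _ _ ih₁ ih₂ => mulPP ih₁ ih₂) (fun _ k ih => powPP ih k) e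

/-- Well-formedness for `toPPN`: every variable index is `< 256`. [folklore] -/
noncomputable def wfN (e : Expr) : Bool :=
  Expr.rec (motive := fun _ => Bool)
    (fun _ => true) (fun _ => true) (fun _ => true) (fun i => Nat.blt i 256) (fun _ ih => ih)
    (fun _ _ ih₁ ih₂ => ih₁ && ih₂) (fun _ _ ih₁ ih₂ => ih₁ && ih₂) (fun _ _ ih₁ ih₂ => ih₁ && ih₂) (fun _ _ ih => ih) e

/-- `(xᵢ − xⱼ) · p` (multiplication by a region / order-hypothesis form). [folklore] -/
noncomputable def rhoPN (i j : Nat) (p : PPoly) : PPoly :=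
  mergeP (smulP 1 (ptabN i) p) (smulP (-1) (ptabN j) p)

/-- Consecutive table entries increase (kernel check). -/
theorem ptabN_lt_succ : ∀ i, i < 255 → ptabN i < ptabN (i + 1) := by decide +kernel

/-- The table is strictly increasing on `0..255`. -/
theorem ptabN_strictMono : ∀ j i, i < j → j < 256 → ptabN i < ptabN j := by
  intro j
  induction j with
  | zero => intro i h; omega
  | succ j ih =>
    intro i hij hj
    rcases Nat.lt_succ_iff_lt_or_eq.mp hij with h | h
    · exact lt_trans (ih i h (by omega)) (ptabN_lt_succ j (by omega))
    · subst h; exact ptabN_lt_succ i (by omega)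

/-- The table is injective on `0..255`. -/
theorem ptabN_inj (i j : Nat) (hi : i < 256) (hj : j < 256) (h : ptabN i = ptabN j) : i = j := by
  rcases lt_trichotomy i j with hlt | heq | hgt
  · exact absurd h (ne_of_lt (ptabN_strictMono j i hlt hj))
  · exact heq
  · exact absurd h.symm (ne_of_lt (ptabN_strictMono i j hgt hi))

/-- The table has `256` entries. -/
theorem ptabList_length : ptabList.length = 256 := by decide +kernel

set_option maxRecDepth 16384 in
/-- Every table entry is prime (`norm_num`). -/
theorem ptabList_prime : ∀ p ∈ ptabList, p.Prime := by
  simp only [ptabList, List.forall_mem_cons]; norm_num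

/-- The table entries `ptabN 0..255` are prime. -/
theorem ptabN_prime (i : Nat) (hi : i < 256) : (ptabN i).Prime := by
  have hl : i < ptabList.length := by rw [ptabList_length]; exact hi
  have h : ptabN i = ptabList[i] := by
    unfold ptabN List.getD; rw [List.getElem?_eq_getElem hl, Option.getD_some]
  rw [h]; exact ptabList_prime _ (List.getElem_mem hl)

/-! ### Semantics -/

section Semantics

variable {R : Type*} [CommRing R]

/-- The monomial with Gödel code `k` at the valuation `v`: `∏_{i<256} (v i) ^ v_{pᵢ}(k)`, and `0` for the code `0`. [folklore] -/
noncomputable def monoN (v : Nat → R) (k : Nat) : R :=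
  if k = 0 then 0 else ∏ i ∈ Finset.range 256, v i ^ padicValNat (ptabN i) k

/-- Value of a `PPoly` at `v`. [folklore] -/
noncomputable def evalP (v : Nat → R) : PPoly → R
  | .nil => 0
  | .cons k c tl => (c : R) * monoN v k + evalP v tl

/-- Value of the polynomial presented by a multiplier tree. [folklore] -/
noncomputable def evalT (v : Nat → R) : MTree → R
  | .leaf c k => (c : R) * monoN v k
  | .node l r => evalT v l + evalT v r

/-- Value of a reflected ring expression at the valuation `v` (numerals as casts). [folklore] -/
noncomputable def evalE (v : Nat → R) : Expr → R
  | .num k => (k : R)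
  | .natCast n => (n : R)
  | .intCast k => (k : R)
  | .var i => v i
  | .neg a => - evalE v a
  | .add a b => evalE v a + evalE v b
  | .sub a b => evalE v a - evalE v b
  | .mul a b => evalE v a * evalE v b
  | .pow a k => evalE v a ^ k

/-- The code `1` is the empty monomial. -/
theorem monoN_one (v : Nat → R) : monoN v 1 = 1 := by simp [monoN]

/-- Multiplicativity of the decoding. [folklore] -/
theorem monoN_mul (v : Nat → R) (k m : Nat) : monoN v (k * m) = monoN v k * monoN v m := by
  by_cases hk : k = 0; · subst hk; simp [monoN]
  by_cases hm : m = 0; · subst hm; simp [monoN]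
  have hkm : k * m ≠ 0 := Nat.mul_ne_zero hk hm
  simp only [monoN, hk, hm, hkm, if_false]
  rw [← Finset.prod_mul_distrib]
  refine Finset.prod_congr rfl fun i hi => ?_
  have hp : Fact (ptabN i).Prime := ⟨ptabN_prime i (Finset.mem_range.mp hi)⟩
  rw [padicValNat.mul hk hm, pow_add]

/-- The code `pᵢ` is the variable `xᵢ`. -/
theorem monoN_ptabN (v : Nat → R) (i : Nat) (hi : i < 256) : monoN v (ptabN i) = v i := by
  have hpi : (ptabN i).Prime := ptabN_prime i hi
  have hne : ptabN i ≠ 0 := hpi.ne_zero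
  simp only [monoN, hne, if_false]
  rw [Finset.prod_eq_single i]
  · haveI : Fact (ptabN i).Prime := ⟨hpi⟩
    rw [padicValNat_self, pow_one]
  · intro j hj hji
    haveI : Fact (ptabN j).Prime := ⟨ptabN_prime j (Finset.mem_range.mp hj)⟩
    haveI : Fact (ptabN i).Prime := ⟨hpi⟩
    have hne' : ptabN j ≠ ptabN i := fun h => hji (ptabN_inj j i (Finset.mem_range.mp hj) hi h)
    rw [padicValNat_primes hne', pow_zero]
  · intro h; exact absurd (Finset.mem_range.mpr hi) h

/-! ### Soundness of the operations -/

/-- Unfolding lemma. -/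
theorem evalP_nil (v : Nat → R) : evalP v .nil = 0 := rfl
/-- Unfolding lemma. -/
theorem evalP_cons (v : Nat → R) (k : Nat) (c : Int) (tl : PPoly) :
    evalP v (.cons k c tl) = (c : R) * monoN v k + evalP v tl := rfl

/-- Soundness of `smulP`. [folklore] -/
theorem evalP_smulP (v : Nat → R) (c : Int) (m : Nat) (p : PPoly) :
    evalP v (smulP c m p) = (c : R) * monoN v m * evalP v p := by
  induction p with
  | nil => show evalP v .nil = _; simp [evalP]
  | cons k c' tl ih =>
    show evalP v (.cons (Nat.mul k m) (Int.mul c c') (smulP c m tl)) = _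
    rw [evalP_cons, ih, evalP_cons]
    simp only [Nat.mul_eq, Int.mul_def, Int.cast_mul, monoN_mul]
    ring

/-- Soundness of `mergeP`: it evaluates to the sum. [folklore] -/
theorem evalP_mergeP (v : Nat → R) (p q : PPoly) : evalP v (mergeP p q) = evalP v p + evalP v q := by
  induction p generalizing q with
  | nil => rw [mergeP_nil, evalP_nil, zero_add]
  | cons k c tl ih =>
    induction q with
    | nil => rw [mergeP_cons_nil, evalP_nil, add_zero]
    | cons k' c' tl' ih' =>
      rw [mergeP_cons_cons]
      cases h1 : Nat.blt k' k
      · cases h2 : Nat.blt k k'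
        · have hkk : k = k' := by
            have a := (Bool.not_eq_true _).mpr h1; have b := (Bool.not_eq_true _).mpr h2; rw [Nat.blt_eq] at a b; omega
          subst hkk
          cases h3 : Int.beq' (Int.add c c') 0
          · show evalP v (.cons k (Int.add c c') (mergeP tl tl')) = _
            rw [evalP_cons, ih, evalP_cons, evalP_cons]
            simp only [Int.add_def, Int.cast_add]; ring
          · show evalP v (mergeP tl tl') = _
            have hcc : c + c' = 0 := by simpa using h3
            rw [ih, evalP_cons, evalP_cons]
            have hcR : (c : R) + (c' : R) = 0 := by rw [← Int.cast_add, hcc, Int.cast_zero]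
            linear_combination (-(monoN v k)) * hcR
        · show evalP v (.cons k' c' (mergeP (.cons k c tl) tl')) = _
          rw [evalP_cons, ih', evalP_cons, evalP_cons]; ring
      · show evalP v (.cons k c (mergeP tl (.cons k' c' tl'))) = _
        rw [evalP_cons, ih, evalP_cons, evalP_cons]; ring

/-- Soundness of `constP`. -/
theorem evalP_constP (v : Nat → R) (k : Int) : evalP v (constP k) = (k : R) := by
  show evalP v (.cons 1 k .nil) = _
  rw [evalP_cons, evalP_nil, monoN_one]; ring

/-- Soundness of `mulPP`. [folklore] -/
theorem evalP_mulPP (v : Nat → R) (p q : PPoly) : evalP v (mulPP p q) = evalP v p * evalP v q := by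
  induction p with
  | nil => show evalP v .nil = _; rw [evalP_nil, zero_mul]
  | cons k c tl ih =>
    show evalP v (mergeP (smulP c k q) (mulPP tl q)) = _
    rw [evalP_mergeP, evalP_smulP, ih, evalP_cons]; ring

/-- Soundness of `powPP`. [folklore] -/
theorem evalP_powPP (v : Nat → R) (p : PPoly) (n : Nat) : evalP v (powPP p n) = evalP v p ^ n := by
  induction n with
  | zero => show evalP v (constP 1) = _; rw [evalP_constP, pow_zero, Int.cast_one]
  | succ n ih => show evalP v (mulPP (powPP p n) p) = _; rw [evalP_mulPP, ih, pow_succ]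

/-- Soundness of `rhoPN` (both variables in range). [folklore] -/
theorem evalP_rhoPN (v : Nat → R) (i j : Nat) (hi : i < 256) (hj : j < 256) (p : PPoly) :
    evalP v (rhoPN i j p) = (v i - v j) * evalP v p := by
  unfold rhoPN
  rw [evalP_mergeP, evalP_smulP, evalP_smulP, monoN_ptabN v i hi, monoN_ptabN v j hj]
  simp only [Int.cast_one, Int.cast_neg]; ring

/-- Soundness of `applyT`: the tree's polynomial times `p`. [folklore] -/
theorem evalP_applyT (v : Nat → R) (t : MTree) (p : PPoly) : evalP v (applyT t p) = evalT v t * evalP v p := by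
  induction t with
  | leaf c k =>
    show evalP v (smulP c k p) = ((c : R) * monoN v k) * evalP v p
    rw [evalP_smulP]
  | node l r ihl ihr =>
    show evalP v (mergeP (applyT l p) (applyT r p)) = (evalT v l + evalT v r) * evalP v p
    rw [evalP_mergeP, ihl, ihr, add_mul]

/-- Soundness of `toPPN` on well-formed expressions: it agrees with `evalE`. [folklore] -/
theorem evalP_toPPN (v : Nat → R) (e : Expr) (hw : wfN e = true) : evalP v (toPPN e) = evalE v e := by
  induction e with
  | num k => show evalP v (constP k) = (k : R); rw [evalP_constP]
  | natCast n => show evalP v (constP n) = (n : R); rw [evalP_constP]; exact Int.cast_natCast n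
  | intCast k => show evalP v (constP k) = (k : R); rw [evalP_constP]
  | var i =>
    have hi : i < 256 := by simpa [wfN] using hw
    show evalP v (.cons (ptabN i) 1 .nil) = v i
    rw [evalP_cons, evalP_nil, monoN_ptabN v i hi]; simp
  | neg a ih =>
    show evalP v (smulP (-1) 1 (toPPN a)) = - evalE v a
    rw [evalP_smulP, ih (by simpa [wfN] using hw), monoN_one]; simp
  | add a b iha ihb =>
    have hw' : wfN a = true ∧ wfN b = true := by simpa [wfN] using hw
    show evalP v (mergeP (toPPN a) (toPPN b)) = evalE v a + evalE v b
    rw [evalP_mergeP, iha hw'.1, ihb hw'.2]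
  | sub a b iha ihb =>
    have hw' : wfN a = true ∧ wfN b = true := by simpa [wfN] using hw
    show evalP v (mergeP (toPPN a) (smulP (-1) 1 (toPPN b))) = evalE v a - evalE v b
    rw [evalP_mergeP, evalP_smulP, iha hw'.1, ihb hw'.2, monoN_one]; simp [sub_eq_add_neg]
  | mul a b iha ihb =>
    have hw' : wfN a = true ∧ wfN b = true := by simpa [wfN] using hw
    show evalP v (mulPP (toPPN a) (toPPN b)) = evalE v a * evalE v b
    rw [evalP_mulPP, iha hw'.1, ihb hw'.2]
  | pow a k ih =>
    show evalP v (powPP (toPPN a) k) = evalE v a ^ k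
    rw [evalP_powPP, ih (by simpa [wfN] using hw)]

/-- Soundness of the zero test: `subCheckP p q` ⇒ `p` and `q` evaluate equally. [folklore] -/
theorem evalP_eq_of_subCheckP (v : Nat → R) (p q : PPoly) (h : subCheckP p q = true) : evalP v p = evalP v q := by
  have hz : evalP v (mergeP p (smulP (-1) 1 q)) = 0 := by
    unfold subCheckP at h
    generalize hr : mergeP p (smulP (-1) 1 q) = r at h
    cases r with
    | nil => rfl
    | cons _ _ _ => exact absurd h (by simp [isNilP])
  rw [evalP_mergeP, evalP_smulP, monoN_one] at hz
  simp only [Int.reduceNeg, Int.cast_neg, Int.cast_one, mul_one, neg_mul, one_mul] at hz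
  linear_combination hz

end Semantics

/-! ### Nonnegativity from nonnegative coefficients -/

section Order

variable {R : Type*} [CommRing R] [LinearOrder R] [IsStrictOrderedRing R]

/-- A monomial is nonnegative at a valuation nonnegative on `0..255`. -/
theorem monoN_nonneg (v : Nat → R) (hx : ∀ i, i < 256 → 0 ≤ v i) (k : Nat) : 0 ≤ monoN v k := by
  unfold monoN
  split_ifs
  · exact le_refl _
  · exact Finset.prod_nonneg fun i hi => pow_nonneg (hx i (Finset.mem_range.mp hi)) _

/-- A `PPoly` with nonnegative coefficients is nonnegative at such a valuation. [folklore] -/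
theorem evalP_nonneg_of_coeffsP (v : Nat → R) (hx : ∀ i, i < 256 → 0 ≤ v i) (p : PPoly) (h : coeffsP p = true) :
    0 ≤ evalP v p := by
  induction p with
  | nil => exact le_refl _
  | cons k c tl ih =>
    have h' : (0 ≤ c ∧ Nat.beq k 0 = false) ∧ coeffsP tl = true := by simpa [coeffsP] using h
    have hc : (0 : R) ≤ (c : R) := by exact_mod_cast h'.1.1
    rw [evalP_cons]; exact add_nonneg (mul_nonneg hc (monoN_nonneg v hx k)) (ih h'.2)

/-- A multiplier tree with nonnegative leaf coefficients is nonnegative at such a valuation. [folklore] -/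
theorem evalT_nonneg_of_coeffsT (v : Nat → R) (hx : ∀ i, i < 256 → 0 ≤ v i) (t : MTree) (h : coeffsT t = true) :
    0 ≤ evalT v t := by
  induction t with
  | leaf c k =>
    have h' : 0 ≤ c ∧ Nat.beq k 0 = false := by simpa [coeffsT] using h
    have hc : (0 : R) ≤ (c : R) := by exact_mod_cast h'.1
    exact mul_nonneg hc (monoN_nonneg v hx k)
  | node l r ihl ihr =>
    have h' : coeffsT l = true ∧ coeffsT r = true := by simpa [coeffsT] using h
    exact add_nonneg (ihl h'.1) (ihr h'.2)

/-- Valuation of a finite cell vector, extended by `0`: the form in which certificate files instantiate `v`. [folklore] -/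
def valOf {m : Nat} (c : Fin m → R) (i : Nat) : R := if h : i < m then c ⟨i, h⟩ else 0

omit [IsStrictOrderedRing R] in
/-- `valOf c` is nonnegative everywhere when the cells are. -/
theorem valOf_nonneg {m : Nat} {c : Fin m → R} (hc : ∀ j, 0 ≤ c j) : ∀ i, i < 256 → 0 ≤ valOf c i := by
  intro i _; unfold valOf; split_ifs with h; exacts [hc _, le_refl _]

omit [LinearOrder R] [IsStrictOrderedRing R] in
/-- `valOf c i = c i` in range. -/
theorem valOf_of_lt {m : Nat} (c : Fin m → R) {i : Nat} (h : i < m) : valOf c i = c ⟨i, h⟩ := by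
  simp [valOf, h]

end Order

/-! ### The certificate schema `M·T = Σ_r m_r·g_r + m₀·1` -/

section Schema

variable {R : Type*} [CommRing R] [LinearOrder R] [IsStrictOrderedRing R]

/-- Right-hand side of a certificate: `Σ_r m_r · g_r + m₀ · 1` for rows `(m_r, g_r)` (multiplier tree, reflected row
polynomial) and a free nonnegative part `m₀`. [folklore] -/
noncomputable def certRHS (pos : MTree) : List (MTree × Expr) → PPoly
  | [] => applyT pos (constP 1)
  | r :: rows => mergeP (applyT r.1 (toPPN r.2)) (certRHS pos rows)

/-- The right-hand side of a certificate is nonnegative at a nonnegative valuation where every row is nonnegative and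
every multiplier has nonnegative coefficients. [folklore] -/
theorem evalP_certRHS_nonneg (v : Nat → R) (hx : ∀ i, i < 256 → 0 ≤ v i) (pos : MTree) (hpos : coeffsT pos = true) :
    ∀ rows : List (MTree × Expr), (∀ r ∈ rows, wfN r.2 = true) → (∀ r ∈ rows, coeffsT r.1 = true) →
      (∀ r ∈ rows, 0 ≤ evalE v r.2) → 0 ≤ evalP v (certRHS pos rows)
  | [], _, _, _ => by
    show 0 ≤ evalP v (applyT pos (constP 1))
    rw [evalP_applyT, evalP_constP, Int.cast_one, mul_one]
    exact evalT_nonneg_of_coeffsT v hx pos hpos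
  | r :: rows, hw, hco, hr => by
    show 0 ≤ evalP v (mergeP (applyT r.1 (toPPN r.2)) (certRHS pos rows))
    rw [evalP_mergeP, evalP_applyT, evalP_toPPN v r.2 (hw r (by simp))]
    exact add_nonneg (mul_nonneg (evalT_nonneg_of_coeffsT v hx r.1 (hco r (by simp))) (hr r (by simp)))
      (evalP_certRHS_nonneg v hx pos hpos rows (fun r' h' => hw r' (by simp [h'])) (fun r' h' => hco r' (by simp [h']))
        (fun r' h' => hr r' (by simp [h'])))

/-- THE SCHEMA.  A kernel-checked identity `M·T = Σ_r m_r·g_r + m₀` (`subCheckP`, by `decide +kernel` in the certificate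
file) with nonnegative multipliers, nonnegative rows and a nonnegative valuation gives `0 ≤ M·T`. [folklore] -/
theorem cert_mul_nonneg (v : Nat → R) (hx : ∀ i, i < 256 → 0 ≤ v i) {eM eT : Expr} {rows : List (MTree × Expr)}
    {pos : MTree} (hwM : wfN eM = true) (hwT : wfN eT = true) (hw : ∀ r ∈ rows, wfN r.2 = true)
    (hchk : subCheckP (mulPP (toPPN eM) (toPPN eT)) (certRHS pos rows) = true)
    (hco : ∀ r ∈ rows, coeffsT r.1 = true) (hpos : coeffsT pos = true) (hrows : ∀ r ∈ rows, 0 ≤ evalE v r.2) :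
    0 ≤ evalE v eM * evalE v eT := by
  have h := evalP_eq_of_subCheckP v _ _ hchk
  rw [evalP_mulPP, evalP_toPPN v eM hwM, evalP_toPPN v eT hwT] at h
  rw [h]; exact evalP_certRHS_nonneg v hx pos hpos rows hw hco hrows

/-- The schema with a positive leading multiplier: `0 ≤ T`. [folklore] -/
theorem cert_nonneg (v : Nat → R) (hx : ∀ i, i < 256 → 0 ≤ v i) {eM eT : Expr} {rows : List (MTree × Expr)}
    {pos : MTree} (hwM : wfN eM = true) (hwT : wfN eT = true) (hw : ∀ r ∈ rows, wfN r.2 = true)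
    (hchk : subCheckP (mulPP (toPPN eM) (toPPN eT)) (certRHS pos rows) = true)
    (hco : ∀ r ∈ rows, coeffsT r.1 = true) (hpos : coeffsT pos = true) (hrows : ∀ r ∈ rows, 0 ≤ evalE v r.2)
    (hM : 0 < evalE v eM) : 0 ≤ evalE v eT :=
  (mul_nonneg_iff_of_pos_left hM).mp (cert_mul_nonneg v hx hwM hwT hw hchk hco hpos hrows)

end Schema

end FaceCertKernelN

end Summit.CriticalPhenomena.PercolationContinuityZ3.Theorems
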